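import Summits.ABC.ABC.Theorems.CongruentialReceptacleTameLocalReceptacleDefs
import Summits.ABC.ABC.Theorems.CongruentialReceptacleTameLocalReceptacleStubCardPrimeFactorsLe
import Summits.ABC.ABC.Theorems.CongruentialReceptacleTameLocalReceptacleStubSharedAtomsLe
import Summits.ABC.ABC.Theorems.CongruentialReceptacleTameLocalReceptacleStubCertificate
import Summits.ABC.ABC.Theorems.CongruentialReceptacleTameLocalReceptacleStubNearResidueFreeOfPinning
import Summits.ABC.ABC.Theorems.CongruentialReceptacleTameLocalReceptacleStubFalseOfNearResidueFree
import Summits.ABC.ABC.Theorems.TameLocalReceptacle.Negative.TameLocalReceptacleFalseOfPinningHypothesis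
import Summits.ABC.ABC.Theorems.CongruentialReceptacleTameLocalReceptacleStubFalseOfMatching

/-!
# LINE SKELETON — crux `TameLocalReceptacle` (stmt-ABC-14354), line `SketchIdeator1`
# (idea `ternary-smooth-pinning`), RESHAPED in cycle 2 by lead prover-line-stmt-ABC-14354-c1-0,
# owned unchanged in cycle 3 by lead c2 and in cycle 4 (gen 1 re-seat) by lead prover-line-stmt-ABC-14354-c3-0

Composition: `not_tameLocalReceptacle : ¬ TameLocalReceptacle`; registered target
`NotTameLocalReceptacle_proof : NotTameLocalReceptacle` (`:= ¬ TameLocalReceptacle`).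

STATE (cycle 3, lead c2): CLOSED MODULO `{stub_analyticInput}` = EH ∨ MF (unchanged stub set; cycle 3 tests the
scale-free / hybrid-design escape hatches of MF against informed-prime rigidity — see the crux `NOTES.md`).  History: the cycle-1 skeleton was closed modulo `stub_pinningFamilies` (EH = entry-wise pinning to
`O(1)`, a log-SAVING in conditioned ternary-friable counts).  RESHAPE: the analytic input is weakened to a
DISJUNCTION — either EH (old branch: `stub_nearResidueFree_of_pinning` + `stub_false_of_nearResidueFree`,
both landed) or the qualitative first-moment matching hypothesis MF = `MatchingFamilies (1/4)` (new branch: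
`stub_false_of_matching`, the five-family first-moment argument — three special families with a member
`2^N·m`, `m` odd generic, two generic families at the scales `X` and `X/2^N`; matching slack `δ·N`, any
`δ > 0`, i.e. relative precision `o(1)` only).  Landed (all `--supports stmt-ABC-14354`): Defs p115028
(`stub_tlr_iff_itr`), p115213, p115684, p115923, p116276, p116469, negative lemma p116736; QL/Kummer-local
unconditional refutations p118031/p118459 (beyond the line).

Registered stubs of the reshaped line:
* `stub_tlr_iff_itr : TameLocalReceptacle ↔ IntegerTameReceptacle` — LANDED (Defs, p115028), imported;
* `stub_false_of_matching : ∀ κ, MatchingFamilies κ → 0 < κ → ¬ IntegerTameReceptacle` — LANDED p120990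
  (`…StubFalseOfMatching.lean`, 377 lines), imported; objects `oddPartA/B/C`, `MatchingFamilies` in Defs (p120792);
* `stub_analyticInput : (∃ A, PinningFamilies (1/2^25) A) ∨ MatchingFamilies (1/4)` — the ANALYTIC INPUT
  (research-level; not expected from a stub-worker): EH OR MF.
-/

-- `Summit.<Summit>.<Problem>` is the mandated summit-side namespace (CONVENTIONS §2); for the
-- single-conjunct summit `ABC` the two coincide, so the duplicate `ABC.ABC` is deliberate.
set_option linter.dupNamespace false

namespace Summit.ABC.ABC.Theorems.TameLocalReceptacle

open Finset Filter Topology Literature.NumberTheory.DiophantineGeometry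
open Summit.ABC.ABC.Theses.CongruentialReceptacle

/-! Objects of the new branch — `oddPartA/B/C`, `MatchingFamilies` — are imported from the Defs file
(APPEND p120792, accepted). -/

/-! ### Registered stubs of the reshaped line -/

/-! `stub_false_of_matching : ∀ κ, MatchingFamilies κ → 0 < κ → ¬ IntegerTameReceptacle` — LANDED (p120990), imported. -/

/-- STUB (THE ANALYTIC INPUT — research-level, NOT expected from a stub-worker): EH (ternary-smooth
residue pinning to `O(1)` at balance `2⁻²⁵`) OR MF (qualitative first-moment matching at balance `1/4`).
Either disjunct closes the line; MF asks only relative precision `o(1)` of conditioned ternary-friable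
tame-data laws (in print in substance: de la Bretèche 1999, Drappeau 2015, Harper 2016), EH a log-saving. -/
theorem stub_analyticInput :
    (∃ A : ℝ, PinningFamilies (1 / 2 ^ 25) A) ∨ MatchingFamilies (1 / 4) := by
  sorry

/-! ### Composition -/

/-- The line's typed target: the NEGATION of the crux decl (refuting line). -/
def NotTameLocalReceptacle : Prop := ¬ TameLocalReceptacle

/-- COMPOSITION (sorry-free modulo the stubs): transfer to the single table (`stub_tlr_iff_itr`), then
EITHER pinning ⇒ near-residue-free ⇒ fourth-power certificate (`stub_nearResidueFree_of_pinning`,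
`stub_false_of_nearResidueFree`, read at `κ = 2⁻²⁵`, `ε = 1`) OR the five-family first-moment argument
(`stub_false_of_matching` at `κ = 1/4`). -/
theorem not_tameLocalReceptacle : ¬ TameLocalReceptacle := by
  intro h
  have hI : IntegerTameReceptacle := stub_tlr_iff_itr.mp h
  rcases stub_analyticInput with ⟨A, hE⟩ | hM
  · obtain ⟨c₁, c₁', c₃, hc₁, t, hw, hB⟩ := hI (1 / 2 ^ 25) (by norm_num) 1 one_pos
    have hc₁' : 0 < c₁' := c₁'_pos_of_inWindow le_rfl hc₁ hw
    exact stub_false_of_nearResidueFree le_rfl (by norm_num) hc₁ t (fun p i j k r s z hp =>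
      (hw p i j k r s z hp).1) (fun a b c h => hB a b c h) (stub_nearResidueFree_of_pinning hc₁' t hw hB hE)
  · exact stub_false_of_matching (1 / 4) hM (by norm_num) hI

/-- **Registered skeleton theorem**: concludes the line's typed target BY NAME from the stubs. -/
theorem NotTameLocalReceptacle_proof : NotTameLocalReceptacle := not_tameLocalReceptacle

end Summit.ABC.ABC.Theorems.TameLocalReceptacle
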